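import Summits.CriticalPhenomena.PercolationContinuityZ3.Theorems.PercNearOneGluingNoHeavyLowerTailForestRayleighTools
import HarnessLib

/-!
# Weighted forest negative correlation on graphs of tree-width ≤ 2 — II: elimination steps at a vertex of degree ≤ 2 (pendant vertex; series vertex carrying `e`)

Notation as in `…ForestRayleighTools`: `Z(D;K) = Σ_{G ⊆ D, ⟨G ∪ K⟩ acyclic} ∏_{g∈G} w g` and the
Rayleigh inequality `(R)(D;K;e,f) : Z(D;K∪{e,f})·Z(D;K) ≤ Z(D;K∪{e})·Z(D;K∪{f})`.

Let `v` be a vertex meeting at most two edges of the instance `E = D ∪ K ∪ {e,f}`. This file proves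
that `(R)` for `E` follows from `(R)` for the instance obtained by eliminating `v` (delete a pendant
`v`; replace a series pair `vu₁, vu₂` by the chord `u₁u₂`, merging activities), in the cases

* `v` pendant: its edge is `e` (no hypothesis needed), is free (`∈ D`), or is pinned (`∈ K`);
* `v` of degree two carrying `e = vu₁`: the other edge is `f` (no hypothesis) or is pinned (the
  case of a free second edge is `…ForestRayleighStepsFree`).

The remaining series cases (both edges of `v` in `D ∪ K`) are in `…ForestRayleighStepsTwo/Three`. This is the
graph-language content of Semple–Welsh, *Negative correlation in graphs and matroids*, CPC 17
(2008), Prop. 3.7 (series–parallel extension preserves independence-correlation), organised for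
an induction along a tree-width-2 elimination ordering. Theorems only; no definitions, no `sorry`.
-/

open Finset SimpleGraph
open scoped Classical

namespace Summit.CriticalPhenomena.PercolationContinuityZ3.Theorems.ForestRayleigh

variable {V : Type*} [Fintype V] [DecidableEq V]

/-! ### §1 Pendant vertex -/

/-- **Pendant vertex whose edge is `e`.** If `v` meets no edge of `D ∪ K ∪ {f}` and `u ≠ v`, then
`(R)(D;K;vu,f)` holds (with equality): pinning the pendant edge `vu` changes nothing.
[S–W Prop. 3.7, trivial case] -/
theorem lsm_pendant_self (w : Sym2 V → ℝ) (D K : Finset (Sym2 V)) (f : Sym2 V) {v u : V}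
    (hDK : ∀ x ∈ D ∪ insert f K, ¬x.IsDiag) (hv : ∀ x ∈ D ∪ insert f K, v ∉ x) (huv : u ≠ v) :
    (∑ G ∈ D.powerset.filter (fun G =>
        (fromEdgeSet ((G ∪ (insert s(v, u) (insert f K)) : Finset (Sym2 V)) : Set (Sym2 V))).IsAcyclic), ∏ x ∈ G, w x) *
      (∑ G ∈ D.powerset.filter (fun G =>
        (fromEdgeSet ((G ∪ K : Finset (Sym2 V)) : Set (Sym2 V))).IsAcyclic), ∏ x ∈ G, w x) ≤
    (∑ G ∈ D.powerset.filter (fun G =>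
        (fromEdgeSet ((G ∪ (insert s(v, u) K) : Finset (Sym2 V)) : Set (Sym2 V))).IsAcyclic), ∏ x ∈ G, w x) *
      (∑ G ∈ D.powerset.filter (fun G =>
        (fromEdgeSet ((G ∪ (insert f K) : Finset (Sym2 V)) : Set (Sym2 V))).IsAcyclic), ∏ x ∈ G, w x) := by
  have hDK' : ∀ x ∈ D ∪ K, ¬x.IsDiag := fun x hx => hDK x (by
    simp only [Finset.mem_union, Finset.mem_insert] at hx ⊢; tauto)
  have hv' : ∀ x ∈ D ∪ K, v ∉ x := fun x hx => hv x (by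
    simp only [Finset.mem_union, Finset.mem_insert] at hx ⊢; tauto)
  rw [forestsW_pin_pendant w D (insert f K) hDK hv huv, forestsW_pin_pendant w D K hDK' hv' huv,
    mul_comm]

/-- **Pendant vertex whose edge is free.** If `v` meets no edge of `D₀ ∪ K ∪ {e,f}`, `u ≠ v`,
then `(R)(D₀ ∪ vu;K;e,f)` follows from `(R)(D₀;K;e,f)` (all four partition functions acquire the
factor `1 + w(vu)`). [S–W Prop. 3.7] -/
theorem lsm_pendant_free (w : Sym2 V → ℝ) (D₀ K : Finset (Sym2 V)) (e f : Sym2 V) {v u : V}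
    (hDK : ∀ x ∈ D₀ ∪ insert e (insert f K), ¬x.IsDiag)
    (hv : ∀ x ∈ D₀ ∪ insert e (insert f K), v ∉ x) (huv : u ≠ v)
    (hred : (∑ G ∈ D₀.powerset.filter (fun G =>
        (fromEdgeSet ((G ∪ (insert e (insert f K)) : Finset (Sym2 V)) : Set (Sym2 V))).IsAcyclic), ∏ x ∈ G, w x) *
      (∑ G ∈ D₀.powerset.filter (fun G =>
        (fromEdgeSet ((G ∪ K : Finset (Sym2 V)) : Set (Sym2 V))).IsAcyclic), ∏ x ∈ G, w x) ≤
    (∑ G ∈ D₀.powerset.filter (fun G =>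
        (fromEdgeSet ((G ∪ (insert e K) : Finset (Sym2 V)) : Set (Sym2 V))).IsAcyclic), ∏ x ∈ G, w x) *
      (∑ G ∈ D₀.powerset.filter (fun G =>
        (fromEdgeSet ((G ∪ (insert f K) : Finset (Sym2 V)) : Set (Sym2 V))).IsAcyclic), ∏ x ∈ G, w x)) :
    (∑ G ∈ (insert s(v, u) D₀).powerset.filter (fun G =>
        (fromEdgeSet ((G ∪ (insert e (insert f K)) : Finset (Sym2 V)) : Set (Sym2 V))).IsAcyclic), ∏ x ∈ G, w x) *
      (∑ G ∈ (insert s(v, u) D₀).powerset.filter (fun G =>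
        (fromEdgeSet ((G ∪ K : Finset (Sym2 V)) : Set (Sym2 V))).IsAcyclic), ∏ x ∈ G, w x) ≤
    (∑ G ∈ (insert s(v, u) D₀).powerset.filter (fun G =>
        (fromEdgeSet ((G ∪ (insert e K) : Finset (Sym2 V)) : Set (Sym2 V))).IsAcyclic), ∏ x ∈ G, w x) *
      (∑ G ∈ (insert s(v, u) D₀).powerset.filter (fun G =>
        (fromEdgeSet ((G ∪ (insert f K) : Finset (Sym2 V)) : Set (Sym2 V))).IsAcyclic), ∏ x ∈ G, w x) := by
  have key : ∀ K' : Finset (Sym2 V), K' ⊆ insert e (insert f K) →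
      (∑ G ∈ (insert s(v, u) D₀).powerset.filter (fun G =>
        (fromEdgeSet ((G ∪ K' : Finset (Sym2 V)) : Set (Sym2 V))).IsAcyclic), ∏ x ∈ G, w x) =
        (1 + w s(v, u)) * (∑ G ∈ D₀.powerset.filter (fun G =>
        (fromEdgeSet ((G ∪ K' : Finset (Sym2 V)) : Set (Sym2 V))).IsAcyclic), ∏ x ∈ G, w x) := by
    intro K' hK'
    have h1 : ∀ x ∈ D₀ ∪ K', ¬x.IsDiag := fun x hx =>
      hDK x (Finset.union_subset_union (subset_refl D₀) hK' hx)
    have h2 : ∀ x ∈ D₀ ∪ K', v ∉ x := fun x hx =>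
      hv x (Finset.union_subset_union (subset_refl D₀) hK' hx)
    exact forestsW_free_pendant w D₀ K' h1 h2 huv
  have sK : K ⊆ insert e (insert f K) :=
    (Finset.subset_insert f K).trans (Finset.subset_insert e _)
  have seK : insert e K ⊆ insert e (insert f K) :=
    Finset.insert_subset_insert e (Finset.subset_insert f K)
  have sfK : insert f K ⊆ insert e (insert f K) := Finset.subset_insert e _
  rw [key _ (subset_refl _), key _ sK, key _ seK, key _ sfK]
  have hc : 0 ≤ (1 + w s(v, u)) * (1 + w s(v, u)) := mul_self_nonneg _
  calc _ = (1 + w s(v, u)) * (1 + w s(v, u)) *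
        ((∑ G ∈ D₀.powerset.filter (fun G =>
        (fromEdgeSet ((G ∪ (insert e (insert f K)) : Finset (Sym2 V)) : Set (Sym2 V))).IsAcyclic), ∏ x ∈ G, w x) *
          (∑ G ∈ D₀.powerset.filter (fun G =>
        (fromEdgeSet ((G ∪ K : Finset (Sym2 V)) : Set (Sym2 V))).IsAcyclic), ∏ x ∈ G, w x)) := by ring
    _ ≤ (1 + w s(v, u)) * (1 + w s(v, u)) *
        ((∑ G ∈ D₀.powerset.filter (fun G =>
        (fromEdgeSet ((G ∪ (insert e K) : Finset (Sym2 V)) : Set (Sym2 V))).IsAcyclic), ∏ x ∈ G, w x) *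
          (∑ G ∈ D₀.powerset.filter (fun G =>
        (fromEdgeSet ((G ∪ (insert f K) : Finset (Sym2 V)) : Set (Sym2 V))).IsAcyclic), ∏ x ∈ G, w x)) :=
        mul_le_mul_of_nonneg_left hred hc
    _ = _ := by ring

/-- **Pendant vertex whose edge is pinned.** If `v` meets no edge of `D ∪ K₀ ∪ {e,f}`, `u ≠ v`,
then `(R)(D;K₀ ∪ vu;e,f)` follows from `(R)(D;K₀;e,f)`. [S–W Prop. 3.7] -/
theorem lsm_pendant_pin (w : Sym2 V → ℝ) (D K₀ : Finset (Sym2 V)) (e f : Sym2 V) {v u : V}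
    (hDK : ∀ x ∈ D ∪ insert e (insert f K₀), ¬x.IsDiag)
    (hv : ∀ x ∈ D ∪ insert e (insert f K₀), v ∉ x) (huv : u ≠ v)
    (hred : (∑ G ∈ D.powerset.filter (fun G =>
        (fromEdgeSet ((G ∪ (insert e (insert f K₀)) : Finset (Sym2 V)) : Set (Sym2 V))).IsAcyclic), ∏ x ∈ G, w x) *
      (∑ G ∈ D.powerset.filter (fun G =>
        (fromEdgeSet ((G ∪ K₀ : Finset (Sym2 V)) : Set (Sym2 V))).IsAcyclic), ∏ x ∈ G, w x) ≤
    (∑ G ∈ D.powerset.filter (fun G =>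
        (fromEdgeSet ((G ∪ (insert e K₀) : Finset (Sym2 V)) : Set (Sym2 V))).IsAcyclic), ∏ x ∈ G, w x) *
      (∑ G ∈ D.powerset.filter (fun G =>
        (fromEdgeSet ((G ∪ (insert f K₀) : Finset (Sym2 V)) : Set (Sym2 V))).IsAcyclic), ∏ x ∈ G, w x)) :
    (∑ G ∈ D.powerset.filter (fun G =>
        (fromEdgeSet ((G ∪ (insert e (insert f (insert s(v, u) K₀))) : Finset (Sym2 V)) : Set (Sym2 V))).IsAcyclic), ∏ x ∈ G, w x) *
      (∑ G ∈ D.powerset.filter (fun G =>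
        (fromEdgeSet ((G ∪ (insert s(v, u) K₀) : Finset (Sym2 V)) : Set (Sym2 V))).IsAcyclic), ∏ x ∈ G, w x) ≤
    (∑ G ∈ D.powerset.filter (fun G =>
        (fromEdgeSet ((G ∪ (insert e (insert s(v, u) K₀)) : Finset (Sym2 V)) : Set (Sym2 V))).IsAcyclic), ∏ x ∈ G, w x) *
      (∑ G ∈ D.powerset.filter (fun G =>
        (fromEdgeSet ((G ∪ (insert f (insert s(v, u) K₀)) : Finset (Sym2 V)) : Set (Sym2 V))).IsAcyclic), ∏ x ∈ G, w x) := by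
  have key : ∀ K' : Finset (Sym2 V), K' ⊆ insert e (insert f K₀) →
      (∑ G ∈ D.powerset.filter (fun G =>
        (fromEdgeSet ((G ∪ (insert s(v, u) K') : Finset (Sym2 V)) : Set (Sym2 V))).IsAcyclic), ∏ x ∈ G, w x) =
        (∑ G ∈ D.powerset.filter (fun G =>
        (fromEdgeSet ((G ∪ K' : Finset (Sym2 V)) : Set (Sym2 V))).IsAcyclic), ∏ x ∈ G, w x) := by
    intro K' hK'
    have h1 : ∀ x ∈ D ∪ K', ¬x.IsDiag := fun x hx =>
      hDK x (Finset.union_subset_union (subset_refl D) hK' hx)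
    have h2 : ∀ x ∈ D ∪ K', v ∉ x := fun x hx =>
      hv x (Finset.union_subset_union (subset_refl D) hK' hx)
    exact forestsW_pin_pendant w D K' h1 h2 huv
  have sK : K₀ ⊆ insert e (insert f K₀) :=
    (Finset.subset_insert f K₀).trans (Finset.subset_insert e _)
  have seK : insert e K₀ ⊆ insert e (insert f K₀) :=
    Finset.insert_subset_insert e (Finset.subset_insert f K₀)
  have sfK : insert f K₀ ⊆ insert e (insert f K₀) := Finset.subset_insert e _
  have c1 : insert e (insert f (insert s(v, u) K₀)) = insert s(v, u) (insert e (insert f K₀)) := by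
    rw [Finset.insert_comm f, Finset.insert_comm e]
  have c2 : insert e (insert s(v, u) K₀) = insert s(v, u) (insert e K₀) := Finset.insert_comm _ _ _
  have c3 : insert f (insert s(v, u) K₀) = insert s(v, u) (insert f K₀) := Finset.insert_comm _ _ _
  rw [c1, c2, c3, key _ (subset_refl _), key _ sK, key _ seK, key _ sfK]
  exact hred

/-! ### §2 Series vertex carrying `e` -/

/-- **Degree-two vertex carrying both `e = vu₁` and `f = vu₂`.** If `v` meets no edge of `D ∪ K`
then `(R)(D;K;vu₁,vu₂)` holds outright: `Z(D;K∪{e,f}) ≤ Z(D;K) = Z(D;K∪e) = Z(D;K∪f)`.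
[S–W Prop. 3.7, case `{e,f} = {b,c}`] -/
theorem lsm_series_self (w : Sym2 V → ℝ) (hw : ∀ x, 0 ≤ w x) (D K : Finset (Sym2 V)) {v u₁ u₂ : V}
    (hDK : ∀ x ∈ D ∪ K, ¬x.IsDiag) (hv : ∀ x ∈ D ∪ K, v ∉ x) (hu₁ : u₁ ≠ v) (hu₂ : u₂ ≠ v) :
    (∑ G ∈ D.powerset.filter (fun G =>
        (fromEdgeSet ((G ∪ (insert s(v, u₁) (insert s(v, u₂) K)) : Finset (Sym2 V)) : Set (Sym2 V))).IsAcyclic), ∏ x ∈ G, w x) *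
      (∑ G ∈ D.powerset.filter (fun G =>
        (fromEdgeSet ((G ∪ K : Finset (Sym2 V)) : Set (Sym2 V))).IsAcyclic), ∏ x ∈ G, w x) ≤
    (∑ G ∈ D.powerset.filter (fun G =>
        (fromEdgeSet ((G ∪ (insert s(v, u₁) K) : Finset (Sym2 V)) : Set (Sym2 V))).IsAcyclic), ∏ x ∈ G, w x) *
      (∑ G ∈ D.powerset.filter (fun G =>
        (fromEdgeSet ((G ∪ (insert s(v, u₂) K) : Finset (Sym2 V)) : Set (Sym2 V))).IsAcyclic), ∏ x ∈ G, w x) := by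
  rw [forestsW_pin_pendant w D K hDK hv hu₁, forestsW_pin_pendant w D K hDK hv hu₂]
  have hle := forestsW_insert_pin_le w hw D (insert s(v, u₂) K) s(v, u₁)
  rw [forestsW_pin_pendant w D K hDK hv hu₂] at hle
  exact mul_le_mul_of_nonneg_right hle
    (forestsW_nonneg w hw D K)


omit [Fintype V] [DecidableEq V] in
/-- Real-algebra step used when a free chord is absorbed: `p a ≤ b c` gives
`p (a + t b) ≤ b (c + t p)`. [elementary] -/
theorem real_absorb {p a b c t : ℝ} (h : p * a ≤ b * c) : p * (a + t * b) ≤ b * (c + t * p) := by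
  nlinarith [h]

set_option maxHeartbeats 400000 in
/-- **Degree-two vertex carrying `e = vu₁`, the other edge `vu₂` pinned.** With `h = u₁u₂` the
chord: `(R)(D;K₀ ∪ vu₂;vu₁,f)` follows from `(R)(D ∖ h;K₀;h,f)` (needed only when `h ∉ K₀`,
`h ≠ f`; if `h ∈ D` its activity is absorbed, if `h ∈ K₀` or `h = f` the pinned triangle makes the
inequality trivial). [S–W Prop. 3.7, case `|{b,c} ∩ {e,f}| = 1`] -/
theorem lsm_series_pin (w : Sym2 V → ℝ) (hw : ∀ x, 0 ≤ w x) (D K₀ : Finset (Sym2 V)) (f : Sym2 V)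
    {v u₁ u₂ : V} (hDK : ∀ x ∈ D ∪ insert s(v, u₁) (insert f (insert s(v, u₂) K₀)), ¬x.IsDiag)
    (hv : ∀ x ∈ D ∪ insert f K₀, v ∉ x) (hu : u₁ ≠ u₂) (hfD : f ∉ D) (hfK : f ∉ K₀)
    (hred : s(u₁, u₂) ∉ K₀ → s(u₁, u₂) ≠ f →
      (∑ G ∈ (D.erase s(u₁, u₂)).powerset.filter (fun G =>
        (fromEdgeSet ((G ∪ (insert s(u₁, u₂) (insert f K₀)) : Finset (Sym2 V)) : Set (Sym2 V))).IsAcyclic), ∏ x ∈ G, w x) *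
      (∑ G ∈ (D.erase s(u₁, u₂)).powerset.filter (fun G =>
        (fromEdgeSet ((G ∪ K₀ : Finset (Sym2 V)) : Set (Sym2 V))).IsAcyclic), ∏ x ∈ G, w x) ≤
    (∑ G ∈ (D.erase s(u₁, u₂)).powerset.filter (fun G =>
        (fromEdgeSet ((G ∪ (insert s(u₁, u₂) K₀) : Finset (Sym2 V)) : Set (Sym2 V))).IsAcyclic), ∏ x ∈ G, w x) *
      (∑ G ∈ (D.erase s(u₁, u₂)).powerset.filter (fun G =>
        (fromEdgeSet ((G ∪ (insert f K₀) : Finset (Sym2 V)) : Set (Sym2 V))).IsAcyclic), ∏ x ∈ G, w x)) :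
    (∑ G ∈ D.powerset.filter (fun G =>
        (fromEdgeSet ((G ∪ (insert s(v, u₁) (insert f (insert s(v, u₂) K₀))) : Finset (Sym2 V)) : Set (Sym2 V))).IsAcyclic), ∏ x ∈ G, w x) *
      (∑ G ∈ D.powerset.filter (fun G =>
        (fromEdgeSet ((G ∪ (insert s(v, u₂) K₀) : Finset (Sym2 V)) : Set (Sym2 V))).IsAcyclic), ∏ x ∈ G, w x) ≤
    (∑ G ∈ D.powerset.filter (fun G =>
        (fromEdgeSet ((G ∪ (insert s(v, u₁) (insert s(v, u₂) K₀)) : Finset (Sym2 V)) : Set (Sym2 V))).IsAcyclic), ∏ x ∈ G, w x) *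
      (∑ G ∈ D.powerset.filter (fun G =>
        (fromEdgeSet ((G ∪ (insert f (insert s(v, u₂) K₀)) : Finset (Sym2 V)) : Set (Sym2 V))).IsAcyclic), ∏ x ∈ G, w x) := by
  have hvu₁ : v ≠ u₁ := fun hh => hDK s(v, u₁) (by simp) (Sym2.mk_isDiag_iff.2 hh)
  have hvu₂ : v ≠ u₂ := fun hh => hDK s(v, u₂) (by simp) (Sym2.mk_isDiag_iff.2 hh)
  have hvf : v ∉ f := hv f (by simp)
  have heD : s(v, u₁) ∉ D := fun hh =>
    hv s(v, u₁) (Finset.mem_union_left _ hh) (Sym2.mem_mk_left _ _)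
  have heK : s(v, u₁) ∉ K₀ := fun hh =>
    hv s(v, u₁) (Finset.mem_union_right _ (Finset.mem_insert_of_mem hh)) (Sym2.mem_mk_left _ _)
  have hef : s(v, u₁) ≠ f := fun hh => hvf (hh ▸ Sym2.mem_mk_left _ _)
  have hgf : s(v, u₂) ≠ f := fun hh => hvf (hh ▸ Sym2.mem_mk_left _ _)
  have hvh : v ∉ s(u₁, u₂) := by
    rw [Sym2.mem_iff]; rintro (hh | hh) <;> [exact hvu₁ hh; exact hvu₂ hh]
  have hhD₀ : ∀ x ∈ D, x ≠ s(u₁, u₂) → True := fun _ _ _ => trivial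
  have hsw : s(u₂, u₁) = s(u₁, u₂) := Sym2.eq_swap
  have hhg : s(u₁, u₂) ≠ s(v, u₂) := fun hh => hvh (hh ▸ Sym2.mem_mk_left _ _)
  have hhe : s(u₁, u₂) ≠ s(v, u₁) := fun hh => hvh (hh ▸ Sym2.mem_mk_left _ _)
  -- (A) the pinned pendant edge `vu₂` is irrelevant as long as `e` is absent
  have nd₀ : ∀ x ∈ D ∪ K₀, ¬x.IsDiag := fun x hx => hDK x (by
    simp only [Finset.mem_union, Finset.mem_insert] at hx ⊢; tauto)
  have ndf : ∀ x ∈ D ∪ insert f K₀, ¬x.IsDiag := fun x hx => hDK x (by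
    simp only [Finset.mem_union, Finset.mem_insert] at hx ⊢; tauto)
  have hv₀ : ∀ x ∈ D ∪ K₀, v ∉ x := fun x hx => hv x (by
    simp only [Finset.mem_union, Finset.mem_insert] at hx ⊢; tauto)
  have eA : (∑ G ∈ D.powerset.filter (fun G =>
        (fromEdgeSet ((G ∪ (insert s(v, u₂) K₀) : Finset (Sym2 V)) : Set (Sym2 V))).IsAcyclic), ∏ x ∈ G, w x) =
      (∑ G ∈ D.powerset.filter (fun G =>
        (fromEdgeSet ((G ∪ K₀ : Finset (Sym2 V)) : Set (Sym2 V))).IsAcyclic), ∏ x ∈ G, w x) := forestsW_pin_pendant w D K₀ nd₀ hv₀ hvu₂.symm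
  have eB : (∑ G ∈ D.powerset.filter (fun G =>
        (fromEdgeSet ((G ∪ (insert f (insert s(v, u₂) K₀)) : Finset (Sym2 V)) : Set (Sym2 V))).IsAcyclic), ∏ x ∈ G, w x) =
      (∑ G ∈ D.powerset.filter (fun G =>
        (fromEdgeSet ((G ∪ (insert f K₀) : Finset (Sym2 V)) : Set (Sym2 V))).IsAcyclic), ∏ x ∈ G, w x) := by
    rw [Finset.insert_comm f s(v, u₂) K₀]
    exact forestsW_pin_pendant w D (insert f K₀) ndf hv hvu₂.symm
  rw [eA, eB]
  -- loop-freeness of the pinned sets carrying `e`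
  have nd₁ : ∀ x ∈ insert s(v, u₁) (insert s(v, u₂) K₀), ¬x.IsDiag := fun x hx => hDK x (by
    simp only [Finset.mem_union, Finset.mem_insert] at hx ⊢; tauto)
  have nd₂ : ∀ x ∈ insert s(v, u₁) (insert f (insert s(v, u₂) K₀)), ¬x.IsDiag := fun x hx =>
    hDK x (Finset.mem_union_right D hx)
  have nd₃ : ∀ x ∈ D ∪ insert s(v, u₂) K₀, ¬x.IsDiag := fun x hx => hDK x (by
    simp only [Finset.mem_union, Finset.mem_insert] at hx ⊢; tauto)
  have nd₃f : ∀ x ∈ D ∪ insert f (insert s(v, u₂) K₀), ¬x.IsDiag := fun x hx => hDK x (by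
    simp only [Finset.mem_union, Finset.mem_insert] at hx ⊢; tauto)
  by_cases hK : s(u₁, u₂) ∈ K₀
  · -- pinned triangle `vu₁, u₁u₂, vu₂`
    rw [forestsW_eq_zero_of_triangle w D _ nd₁ (a := v) (b := u₁) (c := u₂) (by simp)
        (by simp [hK]) (by simp) hvu₁ hu hvu₂,
      forestsW_eq_zero_of_triangle w D _ nd₂ (a := v) (b := u₁) (c := u₂) (by simp)
        (by simp [hK]) (by simp) hvu₁ hu hvu₂, zero_mul, zero_mul]
  by_cases hf : s(u₁, u₂) = f
  · -- `e` re-routes onto `f`; the doubly pinned set contains the triangle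
    have r₁ := forestsW_pin_reroute w D (insert s(v, u₂) K₀) nd₃ (Finset.mem_insert_self _ _) hvu₁
      (Ne.symm hu) (by simp [heD, heK, hu, hvu₂]) (by rw [hsw, hf]; simp [hfD, hfK, Ne.symm hgf])
    rw [hsw, hf, Finset.insert_comm f s(v, u₂) K₀,
      forestsW_pin_pendant w D (insert f K₀) ndf hv hvu₂.symm] at r₁
    rw [r₁, forestsW_eq_zero_of_triangle w D _ nd₂ (a := v) (b := u₁) (c := u₂) (by simp)
        (by rw [hf]; simp) (by simp) hvu₁ hu hvu₂, zero_mul]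
    exact mul_nonneg (forestsW_nonneg w hw _ _) (forestsW_nonneg w hw _ _)
  -- from here on `h ∉ K₀`, `h ≠ f`: re-route `e` onto the chord `h`
  have spec := hred hK hf
  by_cases hD : s(u₁, u₂) ∈ D
  · -- `h ∈ D`: split off `h`; the copies with `h` pinned next to `e, vu₂` vanish (triangle)
    have hD' : D = insert s(u₁, u₂) (D.erase s(u₁, u₂)) := (Finset.insert_erase hD).symm
    have hh₁ : s(u₁, u₂) ∉ D.erase s(u₁, u₂) := Finset.notMem_erase _ _
    have sub₁ : D.erase s(u₁, u₂) ⊆ D := Finset.erase_subset _ _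
    have nd₄ : ∀ x ∈ D.erase s(u₁, u₂) ∪ insert s(v, u₂) K₀, ¬x.IsDiag := fun x hx =>
      nd₃ x (Finset.union_subset_union sub₁ (subset_refl _) hx)
    have nd₅ : ∀ x ∈ D.erase s(u₁, u₂) ∪ insert f (insert s(v, u₂) K₀), ¬x.IsDiag := fun x hx =>
      nd₃f x (Finset.union_subset_union sub₁ (subset_refl _) hx)
    have ndh : ∀ x ∈ D.erase s(u₁, u₂) ∪ insert s(u₁, u₂) K₀, ¬x.IsDiag := by
      intro x hx
      rcases Finset.mem_union.1 hx with hx | hx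
      · exact nd₀ x (Finset.mem_union_left _ (sub₁ hx))
      · rcases Finset.mem_insert.1 hx with rfl | hx
        · exact nd₀ _ (Finset.mem_union_left _ hD)
        · exact nd₀ x (Finset.mem_union_right _ hx)
    have ndhf : ∀ x ∈ D.erase s(u₁, u₂) ∪ insert s(u₁, u₂) (insert f K₀), ¬x.IsDiag := by
      intro x hx
      rcases Finset.mem_union.1 hx with hx | hx
      · exact ndf x (Finset.mem_union_left _ (sub₁ hx))
      · rcases Finset.mem_insert.1 hx with rfl | hx
        · exact nd₀ _ (Finset.mem_union_left _ hD)
        · exact ndf x (Finset.mem_union_right _ hx)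
    have hvh₀ : ∀ x ∈ D.erase s(u₁, u₂) ∪ insert s(u₁, u₂) K₀, v ∉ x := by
      intro x hx
      rcases Finset.mem_union.1 hx with hx | hx
      · exact hv₀ x (Finset.mem_union_left _ (sub₁ hx))
      · rcases Finset.mem_insert.1 hx with rfl | hx
        · exact hvh
        · exact hv₀ x (Finset.mem_union_right _ hx)
    have hvhf : ∀ x ∈ D.erase s(u₁, u₂) ∪ insert s(u₁, u₂) (insert f K₀), v ∉ x := by
      intro x hx
      rcases Finset.mem_union.1 hx with hx | hx
      · exact hv₀ x (Finset.mem_union_left _ (sub₁ hx))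
      · rcases Finset.mem_insert.1 hx with rfl | hx
        · exact hvh
        · exact hv x (Finset.mem_union_right _ hx)
    -- re-routing on `D ∖ h`
    have r₁ := forestsW_pin_reroute w (D.erase s(u₁, u₂)) (insert s(v, u₂) K₀) nd₄
      (Finset.mem_insert_self _ _) hvu₁ (Ne.symm hu)
      (by simp [heD, heK, hu, hvu₂]) (by rw [hsw]; simp [hh₁, hK, hhg])
    rw [hsw, Finset.insert_comm s(u₁, u₂) s(v, u₂) K₀,
      forestsW_pin_pendant w (D.erase s(u₁, u₂)) (insert s(u₁, u₂) K₀) ndh hvh₀ hvu₂.symm] at r₁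
    have c₂ : insert s(u₁, u₂) (insert f (insert s(v, u₂) K₀)) = insert s(v, u₂) (insert s(u₁, u₂) (insert f K₀)) := by
      rw [Finset.insert_comm f s(v, u₂) K₀, Finset.insert_comm s(u₁, u₂) s(v, u₂)]
    have r₂ := forestsW_pin_reroute w (D.erase s(u₁, u₂)) (insert f (insert s(v, u₂) K₀)) nd₅
      (by simp) hvu₁ (Ne.symm hu) (by simp [heD, heK, hu, hef, hvu₂])
      (by rw [hsw]; simp [hh₁, hK, hhg, hf])
    rw [hsw, c₂, forestsW_pin_pendant w (D.erase s(u₁, u₂)) (insert s(u₁, u₂) (insert f K₀)) ndhf hvhf hvu₂.symm] at r₂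
    -- pinned triangles `h, e, vu₂`
    have nd₆ : ∀ x ∈ insert s(u₁, u₂) (insert s(v, u₁) (insert s(v, u₂) K₀)), ¬x.IsDiag := by
      intro x hx
      rcases Finset.mem_insert.1 hx with rfl | hx
      · exact nd₀ _ (Finset.mem_union_left _ hD)
      · exact nd₁ x hx
    have nd₇ : ∀ x ∈ insert s(u₁, u₂) (insert s(v, u₁) (insert f (insert s(v, u₂) K₀))), ¬x.IsDiag := by
      intro x hx
      rcases Finset.mem_insert.1 hx with rfl | hx
      · exact nd₀ _ (Finset.mem_union_left _ hD)
      · exact nd₂ x hx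
    have t₁ := forestsW_eq_zero_of_triangle w (D.erase s(u₁, u₂)) _ nd₆ (a := v) (b := u₁) (c := u₂)
      (by simp) (by simp) (by simp) hvu₁ hu hvu₂
    have t₂ := forestsW_eq_zero_of_triangle w (D.erase s(u₁, u₂)) _ nd₇ (a := v) (b := u₁) (c := u₂)
      (by simp) (by simp) (by simp) hvu₁ hu hvu₂
    rw [hD', forestsW_insert_split w _ _ hh₁, forestsW_insert_split w _ _ hh₁,
      forestsW_insert_split w _ _ hh₁, forestsW_insert_split w _ _ hh₁, r₁, r₂, t₁, t₂]
    simp only [mul_zero, add_zero]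
    exact real_absorb spec
  · -- `h ∉ D`: plain re-routing
    rw [Finset.erase_eq_of_notMem hD] at spec
    have hvh₀ : ∀ x ∈ D ∪ insert s(u₁, u₂) K₀, v ∉ x := by
      intro x hx
      rcases Finset.mem_union.1 hx with hx | hx
      · exact hv₀ x (Finset.mem_union_left _ hx)
      · rcases Finset.mem_insert.1 hx with rfl | hx
        · exact hvh
        · exact hv₀ x (Finset.mem_union_right _ hx)
    have hvhf : ∀ x ∈ D ∪ insert s(u₁, u₂) (insert f K₀), v ∉ x := by
      intro x hx
      rcases Finset.mem_union.1 hx with hx | hx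
      · exact hv₀ x (Finset.mem_union_left _ hx)
      · rcases Finset.mem_insert.1 hx with rfl | hx
        · exact hvh
        · exact hv x (Finset.mem_union_right _ hx)
    have hnd : ¬(s(u₁, u₂) : Sym2 V).IsDiag := fun hh => hu (Sym2.mk_isDiag_iff.1 hh)
    have ndh : ∀ x ∈ D ∪ insert s(u₁, u₂) K₀, ¬x.IsDiag := by
      intro x hx
      rcases Finset.mem_union.1 hx with hx | hx
      · exact nd₀ x (Finset.mem_union_left _ hx)
      · rcases Finset.mem_insert.1 hx with rfl | hx
        · exact hnd
        · exact nd₀ x (Finset.mem_union_right _ hx)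
    have ndhf : ∀ x ∈ D ∪ insert s(u₁, u₂) (insert f K₀), ¬x.IsDiag := by
      intro x hx
      rcases Finset.mem_union.1 hx with hx | hx
      · exact ndf x (Finset.mem_union_left _ hx)
      · rcases Finset.mem_insert.1 hx with rfl | hx
        · exact hnd
        · exact ndf x (Finset.mem_union_right _ hx)
    have r₁ := forestsW_pin_reroute w D (insert s(v, u₂) K₀) nd₃ (Finset.mem_insert_self _ _) hvu₁
      (Ne.symm hu) (by simp [heD, heK, hu, hvu₂]) (by rw [hsw]; simp [hD, hK, hhg])
    rw [hsw, Finset.insert_comm s(u₁, u₂) s(v, u₂) K₀,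
      forestsW_pin_pendant w D (insert s(u₁, u₂) K₀) ndh hvh₀ hvu₂.symm] at r₁
    have c₂ : insert s(u₁, u₂) (insert f (insert s(v, u₂) K₀)) = insert s(v, u₂) (insert s(u₁, u₂) (insert f K₀)) := by
      rw [Finset.insert_comm f s(v, u₂) K₀, Finset.insert_comm s(u₁, u₂) s(v, u₂)]
    have r₂ := forestsW_pin_reroute w D (insert f (insert s(v, u₂) K₀)) nd₃f (by simp) hvu₁
      (Ne.symm hu) (by simp [heD, heK, hu, hef, hvu₂]) (by rw [hsw]; simp [hD, hK, hhg, hf])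
    rw [hsw, c₂, forestsW_pin_pendant w D (insert s(u₁, u₂) (insert f K₀)) ndhf hvhf hvu₂.symm] at r₂
    rw [r₁, r₂]
    exact spec


end Summit.CriticalPhenomena.PercolationContinuityZ3.Theorems.ForestRayleigh
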